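import Literature.Geometry.Lorentzian.GeodesicUniformTime
import Literature.Geometry.Lorentzian.GeodesicMaximalFlow
import Literature.Geometry.Lorentzian.ChartCalculus

/-!
# Escape lemma for maximal geodesics (helper file for `KerrZeroEnergyUntrappedKS`,
# stmt-FinalStateConjecture-13857, route ZeroEnergyKerrOrBomb)

General facts about the maximal geodesics of a `C¹` covariant derivative `cov` on the tangent bundle
of a Hausdorff manifold `M` without boundary (finite-dimensional complete model space), in the
framework of `Literature.Geometry.Lorentzian.Geodesic`:

* `isMaximalGeodesicOn_add_mem_of_isGeodesicOn` — if a geodesic on `(-ε, ε)` has the tangent lift of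
  a maximal geodesic `γ` (domain `s`) at `t₁ ∈ s` as its initial datum, then `(t₁ - ε, t₁ + ε) ⊆ s`
  (O'Neill 1983, Ch. 3, Prop. 24: every geodesic with the initial data of `γ_v` lives inside the
  domain of `γ_v`);
* `isMaximalGeodesicOn_not_bddAbove_of_isCompact`, `isMaximalGeodesicOn_not_bddBelow_of_isCompact` —
  the **escape lemma** (O'Neill 1983, Ch. 5, Lemma 8; Lee 2018, Lemma 6.19): if the tangent lifts
  `(γ t, γ' t)` of a maximal geodesic for `t ≥ t₀` (resp. `t ≤ t₀`) in its domain all lie in one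
  compact subset of `TM`, the domain is unbounded above (resp. below) — uniform existence time on the
  compact set (`exists_uniform_isGeodesicOn_of_isCompact`) and the previous item;
* `OpensChart.exists_isCompact_tangentBundle` — on an open subset `U` of a finite-dimensional normed
  space the tangent vectors over a compact `K ⊆ U` of norm `≤ B` lie in a compact subset of `TU`
  (the preferred trivialisation of `TU` is the identity, `OpensChart.trivializationAt_apply`).

## References

* B. O'Neill, *Semi-Riemannian geometry with applications to relativity*, Academic Press 1983,
  Ch. 3, Prop. 24 (p. 68); Ch. 5, Lemma 8 (p. 130).
* J. M. Lee, *Introduction to Riemannian Manifolds*, 2nd ed., GTM 176 (2018), Lemma 6.19.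
-/

noncomputable section

set_option linter.dupNamespace false

namespace Summit.FinalStateConjecture.FinalStateConjecture.Theorems

open Set Filter Metric Bundle TopologicalSpace Literature.Geometry.Lorentzian
  Literature.Geometry.Riemannian
open scoped Manifold ContDiff Topology

universe u

section Escape

variable {E : Type u} [NormedAddCommGroup E] [NormedSpace ℝ E] {H : Type*} [TopologicalSpace H]
  {I : ModelWithCorners ℝ E H} {M : Type*} [TopologicalSpace M] [ChartedSpace H M]
  [IsManifold I ∞ M] [FiniteDimensional ℝ E]
  {cov : CovariantDerivative I E (TangentSpace I : M → Type _)}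
  [CompleteSpace E] [T2Space M] [BoundarylessManifold I M]
  [CovariantDerivative.ContMDiffCovariantDerivative cov 1]

/-- **A local geodesic through a tangent lift of a maximal geodesic lives inside its domain**
(O'Neill 1983, Ch. 3, Prop. 24, "`J ⊂ I_v`"): if `γ` is a maximal geodesic on `s`, `t₁ ∈ s`, and
`β` is a geodesic on `(-ε, ε)` with `tangentLift β 0 = tangentLift γ t₁`, then `u + t₁ ∈ s` for every
`u ∈ (-ε, ε)`. Proof: the translate `u ↦ γ (u + t₁)` is the maximal geodesic with the initial data of
`β` (`IsMaximalGeodesicOn.comp_add`, `maximalGeodesic_unique`), whose domain contains `(-ε, ε)`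
(`Ioo_subset_maximalGeodesicDomain_of_isGeodesicOn`). -/
theorem isMaximalGeodesicOn_add_mem_of_isGeodesicOn {γ : ℝ → M} {s : Set ℝ}
    (hγ : IsMaximalGeodesicOn cov γ s) {t₁ : ℝ} (ht₁ : t₁ ∈ s) {β : ℝ → M} {ε : ℝ} (hε : 0 < ε)
    (hβ : IsGeodesicOn cov β (Ioo (-ε) ε)) (h0 : tangentLift I β 0 = tangentLift I γ t₁)
    {u : ℝ} (hu : u ∈ Ioo (-ε) ε) : u + t₁ ∈ s := by
  have htr := hγ.comp_add t₁
  have h0' : (0 : ℝ) ∈ {u : ℝ | u + t₁ ∈ s} := by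
    show (0 : ℝ) + t₁ ∈ s
    rw [zero_add]; exact ht₁
  have hx : (fun u ↦ γ (u - (-t₁))) 0 = (tangentLift I γ t₁).proj := by simp
  have hv : velocity I (fun u ↦ γ (u - (-t₁))) 0 = (tangentLift I γ t₁).snd := by
    rw [velocity_comp_sub_const, tangentLift_snd, zero_sub, neg_neg]
  obtain ⟨hdom, -⟩ := maximalGeodesic_unique htr h0' hx hv
  obtain ⟨hsub, -⟩ := Ioo_subset_maximalGeodesicDomain_of_isGeodesicOn (cov := cov) hε hβ h0
  have hmem : u ∈ {u : ℝ | u + t₁ ∈ s} := by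
    rw [hdom]; exact hsub hu
  exact hmem

/-- **Escape lemma, upper end** (O'Neill 1983, Ch. 5, Lemma 8; Lee 2018, Lemma 6.19): if `γ` is a
maximal geodesic on `s ∋ t₀` and the tangent lifts `(γ t, γ' t)`, `t ∈ s`, `t ≥ t₀`, all lie in a
compact set `𝒦 ⊆ TM`, then `s` is not bounded above. Proof: `𝒦` has a uniform existence time `ε`
(`exists_uniform_isGeodesicOn_of_isCompact`); a parameter `t₁ ∈ s` within `ε/2` of `sup s` then has
`t₁ + ε/2 ∈ s` by `isMaximalGeodesicOn_add_mem_of_isGeodesicOn`, exceeding the supremum. -/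
theorem isMaximalGeodesicOn_not_bddAbove_of_isCompact {γ : ℝ → M} {s : Set ℝ}
    (hγ : IsMaximalGeodesicOn cov γ s) {t₀ : ℝ} (ht₀ : t₀ ∈ s) {𝒦 : Set (TangentBundle I M)}
    (h𝒦 : IsCompact 𝒦) (hin : ∀ t ∈ s, t₀ ≤ t → tangentLift I γ t ∈ 𝒦) : ¬ BddAbove s := by
  intro hbdd
  obtain ⟨ε, hε, huni⟩ := exists_uniform_isGeodesicOn_of_isCompact (cov := cov) h𝒦
  have hne : s.Nonempty := ⟨t₀, ht₀⟩
  obtain ⟨t₁', ht₁'s, ht₁'⟩ := exists_lt_of_lt_csSup hne (show sSup s - ε / 2 < sSup s by linarith)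
  -- a parameter `t₁ ≥ t₀` of `s` within `ε/2` of the supremum
  obtain ⟨t₁, ht₁s, ht₀₁, ht₁⟩ : ∃ t₁ ∈ s, t₀ ≤ t₁ ∧ sSup s - ε / 2 < t₁ := by
    rcases le_total t₀ t₁' with h | h
    · exact ⟨t₁', ht₁'s, h, ht₁'⟩
    · exact ⟨t₀, ht₀, le_rfl, ht₁'.trans_le h⟩
  obtain ⟨β, hβ, hβ0⟩ := huni _ (hin t₁ ht₁s ht₀₁)
  have hmem : ε / 2 + t₁ ∈ s :=
    isMaximalGeodesicOn_add_mem_of_isGeodesicOn hγ ht₁s hε hβ hβ0 ⟨by linarith, by linarith⟩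
  have := le_csSup hbdd hmem
  linarith

/-- **Escape lemma, lower end**: the time dual of `isMaximalGeodesicOn_not_bddAbove_of_isCompact` —
if the tangent lifts `(γ t, γ' t)`, `t ∈ s`, `t ≤ t₀`, of a maximal geodesic all lie in a compact
subset of `TM`, then `s` is not bounded below (O'Neill 1983, Ch. 5, Lemma 8). -/
theorem isMaximalGeodesicOn_not_bddBelow_of_isCompact {γ : ℝ → M} {s : Set ℝ}
    (hγ : IsMaximalGeodesicOn cov γ s) {t₀ : ℝ} (ht₀ : t₀ ∈ s) {𝒦 : Set (TangentBundle I M)}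
    (h𝒦 : IsCompact 𝒦) (hin : ∀ t ∈ s, t ≤ t₀ → tangentLift I γ t ∈ 𝒦) : ¬ BddBelow s := by
  intro hbdd
  obtain ⟨ε, hε, huni⟩ := exists_uniform_isGeodesicOn_of_isCompact (cov := cov) h𝒦
  have hne : s.Nonempty := ⟨t₀, ht₀⟩
  obtain ⟨t₁', ht₁'s, ht₁'⟩ := exists_lt_of_csInf_lt hne (show sInf s < sInf s + ε / 2 by linarith)
  obtain ⟨t₁, ht₁s, ht₀₁, ht₁⟩ : ∃ t₁ ∈ s, t₁ ≤ t₀ ∧ t₁ < sInf s + ε / 2 := by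
    rcases le_total t₁' t₀ with h | h
    · exact ⟨t₁', ht₁'s, h, ht₁'⟩
    · exact ⟨t₀, ht₀, le_rfl, h.trans_lt ht₁'⟩
  obtain ⟨β, hβ, hβ0⟩ := huni _ (hin t₁ ht₁s ht₀₁)
  have hmem : -(ε / 2) + t₁ ∈ s :=
    isMaximalGeodesicOn_add_mem_of_isGeodesicOn hγ ht₁s hε hβ hβ0 ⟨by linarith, by linarith⟩
  have := csInf_le hbdd hmem
  linarith

/-- A nonempty open order-connected set of reals which is neither bounded above nor bounded below is
all of `ℝ`. -/
theorem eq_univ_of_not_bddAbove_of_not_bddBelow {s : Set ℝ} (hsc : s.OrdConnected)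
    (ha : ¬ BddAbove s) (hb : ¬ BddBelow s) : s = univ := by
  refine eq_univ_of_forall fun t ↦ ?_
  obtain ⟨x, hxs, htx⟩ := not_bddAbove_iff.1 ha t
  obtain ⟨y, hys, hyt⟩ := not_bddBelow_iff.1 hb t
  exact hsc.out hys hxs ⟨hyt.le, htx.le⟩

/-- **A maximal geodesic whose tangent lifts on each half-domain lie in compact subsets of `TM` is
complete**: if for some `t₀ ∈ s` the lifts for `t ≥ t₀` lie in a compact `𝒦p` and those for
`t ≤ t₀` in a compact `𝒦m`, then `s = ℝ` (O'Neill 1983, Ch. 5, Lemma 8). -/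
theorem isMaximalGeodesicOn_eq_univ_of_isCompact {γ : ℝ → M} {s : Set ℝ}
    (hγ : IsMaximalGeodesicOn cov γ s) {t₀ : ℝ} (ht₀ : t₀ ∈ s) {𝒦p 𝒦m : Set (TangentBundle I M)}
    (hp : IsCompact 𝒦p) (hm : IsCompact 𝒦m) (hinp : ∀ t ∈ s, t₀ ≤ t → tangentLift I γ t ∈ 𝒦p)
    (hinm : ∀ t ∈ s, t ≤ t₀ → tangentLift I γ t ∈ 𝒦m) : s = univ :=
  eq_univ_of_not_bddAbove_of_not_bddBelow hγ.2.1
    (isMaximalGeodesicOn_not_bddAbove_of_isCompact hγ ht₀ hp hinp)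
    (isMaximalGeodesicOn_not_bddBelow_of_isCompact hγ ht₀ hm hinm)

end Escape

/-! ### Compact sets of tangent vectors over an open subset of a normed space -/

section OpensChart

variable {E : Type*} [NormedAddCommGroup E] [NormedSpace ℝ E] [FiniteDimensional ℝ E] {U : Opens E}

/-- **Bounded tangent vectors over a compact set form a relatively compact subset of `TU`.** For an
open subset `U` of a finite-dimensional real normed space, a compact `K ⊆ U` and a bound `B`, there is
a compact `𝒦 ⊆ TU` containing every tangent vector `⟨z, v⟩` with `z ∈ K` and `‖v‖ ≤ B`: the preferred
trivialisation of `TU` (at any point) is the identity `⟨z, v⟩ ↦ (z, v)` on all of `TU`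
(`OpensChart.trivializationAt_apply`), and `𝒦` is the image of `K × closedBall 0 B` under its
(continuous) inverse. -/
theorem OpensChart.exists_isCompact_tangentBundle {K : Set U} (hK : IsCompact K) (B : ℝ) :
    ∃ 𝒦 : Set (TangentBundle 𝓘(ℝ, E) U), IsCompact 𝒦 ∧
      ∀ (z : U) (v : E), z ∈ K → ‖v‖ ≤ B → (⟨z, v⟩ : TangentBundle 𝓘(ℝ, E) U) ∈ 𝒦 := by
  rcases K.eq_empty_or_nonempty with hKe | ⟨x, -⟩
  · exact ⟨∅, isCompact_empty, fun z v hz _ ↦ by simp [hKe] at hz⟩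
  set e := trivializationAt E (TangentSpace 𝓘(ℝ, E)) x with he
  have hbase : e.baseSet = univ := by
    simp [he, OpensChart.chartAt_source]
  have htarget : K ×ˢ closedBall (0 : E) B ⊆ e.target := by
    rw [e.target_eq, hbase]
    exact prod_mono (subset_univ _) (subset_univ _)
  refine ⟨e.toPartialHomeomorph.symm '' (K ×ˢ closedBall (0 : E) B),
    (hK.prod (isCompact_closedBall (0 : E) B)).image_of_continuousOn
      (e.toPartialHomeomorph.continuousOn_symm.mono htarget), fun z v hz hv ↦ ?_⟩
  have hsrc : (⟨z, v⟩ : TangentBundle 𝓘(ℝ, E) U) ∈ e.source := by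
    rw [e.mem_source, hbase]; exact mem_univ _
  refine ⟨(z, v), ⟨hz, mem_closedBall_zero_iff.2 hv⟩, ?_⟩
  have happ : e (⟨z, v⟩ : TangentBundle 𝓘(ℝ, E) U) = (z, v) := OpensChart.trivializationAt_apply x z v
  rw [← happ]
  exact e.toPartialHomeomorph.left_inv hsrc

end OpensChart

end Summit.FinalStateConjecture.FinalStateConjecture.Theorems

end
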